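import Mathlib
import Literature.Barriers.PneNP.MonotoneGap

/-!
# Planted block embedding (stub `stub_embedding` of line `Sketch`, crux `RazWigdersonMatching`)

The static "planted block embedding" behind the Raz–Wigderson lower bound for monotone formulas
computing bipartite perfect matching `PM_n` (Raz–Wigderson 1992, Thm. 4.2, vertex duplication;
Rao–Yehudayoff, *Communication Complexity*, Thm. 9.5, planted edge).

For `2u + 1 ≤ n`, pairs `(x, y)` of `u`-bit vectors are mapped to instances of the monotone
Karchmer–Wigderson game of `PM_n`:

* rows/columns `a i := i`, `b i := i + u` (`i < u`) and the planted index `q := 2u`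
  (`exists_gadget`: all that is used is that `a`, `b` are injective with disjoint ranges
  avoiding `q`);
* Alice's input `eA x` is the permutation matrix of an involution `M x` swapping `a i ↔ b i`
  for every `i` with `x i = 1` and fixing `q` (`exists_involution`), so `PM (eA x) = 1`;
* Bob's input `eB y` has cell `(r, c)` unset iff `r ∈ S_y := {a i : y i = 1} ∪ {q}` and
  `c ∉ T_y := {a i : y i = 1}`; a perfect matching would inject `S_y` (of size `|y| + 1`) into
  `T_y` (of size `|y|`), so `PM (eB y) = 0`;
* the answers (cells set for Alice and unset for Bob) are exactly the planted cell `p := (q, q)`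
  and the cells `(a i, b i)` with `x i = y i = 1`, so there are `|x ∩ y| + 1` of them;
* for the answer `(a i, b i)` the relabelling `(swap (a i) q, swap (b i) q)` fixes both inputs and
  carries `p` to it (stabiliser transitivity).

No auxiliary definitions are introduced: the gadget data are obtained from existence lemmas and
Alice's/Bob's inputs are written out as explicit Boolean terms.
-/

set_option linter.dupNamespace false

noncomputable section

namespace Summit.ValiantsHypothesis.ValiantsHypothesis.Theorems.ShallowShadowsRazWigdersonMatching

open Literature.Barriers.PneNP (perfectMatchingFn perfectMatchingFn_eq_true_iff)

/-! ### The gadget data -/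

/-- The gadget indices exist for `2u + 1 ≤ n`: `a i := i`, `b i := i + u`, `q := 2u`; `a` and `b`
are injective with disjoint ranges, both avoiding `q`. -/
private theorem exists_gadget {n u : ℕ} (hn : 2 * u + 1 ≤ n) :
    ∃ (a b : Fin u → Fin n) (q : Fin n), Function.Injective a ∧ Function.Injective b ∧
      (∀ i j, a i ≠ b j) ∧ (∀ i, a i ≠ q) ∧ (∀ i, b i ≠ q) := by
  refine ⟨fun i => ⟨i, by have := i.2; omega⟩, fun i => ⟨i + u, by have := i.2; omega⟩,
    ⟨2 * u, by omega⟩, ?_, ?_, ?_, ?_, ?_⟩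
  · intro i j h
    simp only [Fin.mk.injEq] at h
    exact Fin.ext h
  · intro i j h
    simp only [Fin.mk.injEq] at h
    exact Fin.ext (by omega)
  · intro i j h
    simp only [Fin.mk.injEq] at h
    have := i.2
    omega
  · intro i h
    simp only [Fin.mk.injEq] at h
    have := i.2
    omega
  · intro i h
    simp only [Fin.mk.injEq] at h
    have := i.2
    omega

/-- Alice's block involution exists: it swaps `a i ↔ b i` for the blocks with `x i = 1` and is
the identity elsewhere (in particular on the blocks with `x i = 0` and on `q`). -/
private theorem exists_involution {n u : ℕ} {a b : Fin u → Fin n} {q : Fin n}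
    (ha : Function.Injective a) (hb : Function.Injective b) (hab : ∀ i j, a i ≠ b j)
    (haq : ∀ i, a i ≠ q) (hbq : ∀ i, b i ≠ q) (x : Fin u → Bool) :
    ∃ Mx : Fin n → Fin n, Function.Involutive Mx ∧ (∀ i, x i = true → Mx (a i) = b i) ∧
      (∀ i, x i = false → Mx (a i) = a i) ∧ Mx q = q := by
  let Mx : Fin n → Fin n := fun r =>
    if h : ∃ i, x i = true ∧ r = a i then b h.choose
    else if h' : ∃ i, x i = true ∧ r = b i then a h'.choose
    else r
  have hMa : ∀ i, x i = true → Mx (a i) = b i := by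
    intro i hx
    have h : ∃ j, x j = true ∧ a i = a j := ⟨i, hx, rfl⟩
    simp only [Mx]
    rw [dif_pos h, (ha h.choose_spec.2).symm]
  have hMa' : ∀ i, x i = false → Mx (a i) = a i := by
    intro i hx
    have h1 : ¬ ∃ j, x j = true ∧ a i = a j := by
      rintro ⟨j, hj, hij⟩
      rw [ha hij, hj] at hx
      exact Bool.noConfusion hx
    have h2 : ¬ ∃ j, x j = true ∧ a i = b j := fun ⟨j, _, hij⟩ => hab i j hij
    simp only [Mx]
    rw [dif_neg h1, dif_neg h2]
  have hMb : ∀ i, x i = true → Mx (b i) = a i := by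
    intro i hx
    have h1 : ¬ ∃ j, x j = true ∧ b i = a j := fun ⟨j, _, hij⟩ => hab j i hij.symm
    have h2 : ∃ j, x j = true ∧ b i = b j := ⟨i, hx, rfl⟩
    simp only [Mx]
    rw [dif_neg h1, dif_pos h2, (hb h2.choose_spec.2).symm]
  have hMq : Mx q = q := by
    have h1 : ¬ ∃ j, x j = true ∧ q = a j := fun ⟨j, _, h⟩ => haq j h.symm
    have h2 : ¬ ∃ j, x j = true ∧ q = b j := fun ⟨j, _, h⟩ => hbq j h.symm
    simp only [Mx]
    rw [dif_neg h1, dif_neg h2]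
  refine ⟨Mx, fun r => ?_, hMa, hMa', hMq⟩
  by_cases h : ∃ i, x i = true ∧ r = a i
  · obtain ⟨i, hx, rfl⟩ := h
    rw [hMa i hx, hMb i hx]
  by_cases h' : ∃ i, x i = true ∧ r = b i
  · obtain ⟨i, hx, rfl⟩ := h'
    rw [hMb i hx, hMa i hx]
  have hr : Mx r = r := by
    simp only [Mx]
    rw [dif_neg h, dif_neg h']
  rw [hr, hr]

/-! ### The embedding for abstract gadget data

Throughout, `a b : Fin u → Fin n`, `q : Fin n` are the gadget indices and `M x` is Alice's
involution; Alice's input is `eA x (r, c) := decide (c = M x r)` and Bob's input is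
`eB y (r, c) := !decide ((r = q ∨ ∃ i, y i ∧ r = a i) ∧ ¬ ∃ i, y i ∧ c = a i)`
(unset iff `r ∈ S_y` and `c ∉ T_y`). -/

section Core

variable {n u : ℕ} {a b : Fin u → Fin n} {q : Fin n} {M : (Fin u → Bool) → Fin n → Fin n}

/-- `PM (eA x) = 1`, witnessed by the involution `M x` itself. -/
private theorem pm_inA (hM : ∀ x, Function.Involutive (M x)) (x : Fin u → Bool) :
    perfectMatchingFn n (fun e => decide (e.2 = M x e.1)) = true := by
  rw [perfectMatchingFn_eq_true_iff]
  exact ⟨Function.Involutive.toPerm _ (hM x), fun r => by simp⟩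

/-- `PM (eB y) = 0`: a perfect matching would inject `S_y = T_y ∪ {q}` into `T_y`. -/
private theorem pm_inB (haq : ∀ i, a i ≠ q) (y : Fin u → Bool) :
    perfectMatchingFn n (fun e => !decide ((e.1 = q ∨ ∃ i, y i = true ∧ e.1 = a i) ∧
      ¬ ∃ i, y i = true ∧ e.2 = a i)) = false := by
  rw [Bool.eq_false_iff, Ne, perfectMatchingFn_eq_true_iff]
  rintro ⟨σ, hσ⟩
  have hmaps : ∀ r ∈ (Finset.univ.filter fun r : Fin n => r = q ∨ ∃ i, y i = true ∧ r = a i),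
      σ r ∈ (Finset.univ.filter fun c : Fin n => ∃ i, y i = true ∧ c = a i) := by
    intro r hr
    simp only [Finset.mem_filter, Finset.mem_univ, true_and] at hr ⊢
    by_contra hc
    have h1 := hσ r
    simp only [Bool.not_eq_true', decide_eq_false_iff_not] at h1
    exact h1 ⟨hr, hc⟩
  have hcard := Finset.card_le_card_of_injOn σ (fun r hr => hmaps r hr) σ.injective.injOn
  have hS : (Finset.univ.filter fun r : Fin n => r = q ∨ ∃ i, y i = true ∧ r = a i) =
      insert q (Finset.univ.filter fun c : Fin n => ∃ i, y i = true ∧ c = a i) := by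
    ext r
    simp
  have hq : q ∉ (Finset.univ.filter fun c : Fin n => ∃ i, y i = true ∧ c = a i) := by
    simp only [Finset.mem_filter, Finset.mem_univ, true_and, not_exists, not_and]
    intro i _ h
    exact haq i h.symm
  rw [hS, Finset.card_insert_of_notMem hq] at hcard
  omega

/-- The answers of `(eA x, eB y)` (cells set for Alice and unset for Bob) are the planted cell
`(q, q)` and the cells `(a i, b i)` with `x i = y i = 1`. -/
private theorem answer_iff (hab : ∀ i j, a i ≠ b j) (haq : ∀ i, a i ≠ q)
    (hM : ∀ x, Function.Involutive (M x) ∧ (∀ i, x i = true → M x (a i) = b i) ∧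
      (∀ i, x i = false → M x (a i) = a i) ∧ M x q = q)
    (x y : Fin u → Bool) (e : Fin n × Fin n) :
    (decide (e.2 = M x e.1) = true ∧
      (!decide ((e.1 = q ∨ ∃ i, y i = true ∧ e.1 = a i) ∧ ¬ ∃ i, y i = true ∧ e.2 = a i)) =
        false) ↔
      (e = (q, q) ∨ ∃ i, (x i && y i) = true ∧ (a i, b i) = e) := by
  obtain ⟨-, hMa, hMa', hMq⟩ := hM x
  obtain ⟨r, c⟩ := e
  simp only [decide_eq_true_eq, Bool.not_eq_false', Prod.mk.injEq, Bool.and_eq_true]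
  constructor
  · rintro ⟨hc, hr, hcT⟩
    rcases hr with rfl | ⟨i, hyi, rfl⟩
    · exact Or.inl ⟨rfl, by rw [hc, hMq]⟩
    · right
      cases hxi : x i
      · rw [hMa' i hxi] at hc
        exact absurd ⟨i, hyi, hc⟩ hcT
      · exact ⟨i, ⟨hxi, hyi⟩, rfl, by rw [hc, hMa i hxi]⟩
  · rintro (⟨rfl, rfl⟩ | ⟨i, ⟨hxi, hyi⟩, rfl, rfl⟩)
    · exact ⟨hMq.symm, Or.inl rfl, fun ⟨j, _, h⟩ => haq j h.symm⟩
    · exact ⟨(hMa i hxi).symm, Or.inr ⟨i, hyi, rfl⟩, fun ⟨j, _, h⟩ => hab j i h.symm⟩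

/-- The answer set as an explicit finset. -/
private theorem answers_eq (hab : ∀ i j, a i ≠ b j) (haq : ∀ i, a i ≠ q)
    (hM : ∀ x, Function.Involutive (M x) ∧ (∀ i, x i = true → M x (a i) = b i) ∧
      (∀ i, x i = false → M x (a i) = a i) ∧ M x q = q)
    (x y : Fin u → Bool) :
    (Finset.univ.filter fun e : Fin n × Fin n => decide (e.2 = M x e.1) = true ∧
      (!decide ((e.1 = q ∨ ∃ i, y i = true ∧ e.1 = a i) ∧ ¬ ∃ i, y i = true ∧ e.2 = a i)) =
        false) =
      insert (q, q)
        ((Finset.univ.filter fun i : Fin u => (x i && y i) = true).image fun i => (a i, b i)) := by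
  ext e
  simp only [Finset.mem_filter, Finset.mem_univ, true_and, Finset.mem_insert, Finset.mem_image,
    answer_iff hab haq hM]

/-- `#answers = |x ∩ y| + 1`. -/
private theorem card_answers (ha : Function.Injective a) (hab : ∀ i j, a i ≠ b j)
    (haq : ∀ i, a i ≠ q)
    (hM : ∀ x, Function.Involutive (M x) ∧ (∀ i, x i = true → M x (a i) = b i) ∧
      (∀ i, x i = false → M x (a i) = a i) ∧ M x q = q)
    (x y : Fin u → Bool) :
    (Finset.univ.filter fun e : Fin n × Fin n => decide (e.2 = M x e.1) = true ∧
      (!decide ((e.1 = q ∨ ∃ i, y i = true ∧ e.1 = a i) ∧ ¬ ∃ i, y i = true ∧ e.2 = a i)) =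
        false).card =
      (Finset.univ.filter fun i : Fin u => (x i && y i) = true).card + 1 := by
  have hinj : Function.Injective (fun i : Fin u => (a i, b i)) :=
    fun i j h => ha (Prod.mk.inj h).1
  have hnot : (q, q) ∉
      ((Finset.univ.filter fun i : Fin u => (x i && y i) = true).image fun i => (a i, b i)) := by
    simp only [Finset.mem_image, Finset.mem_filter, Finset.mem_univ, true_and, not_exists,
      not_and]
    intro i _ h
    exact haq i (Prod.mk.inj h).1
  rw [answers_eq hab haq hM, Finset.card_insert_of_notMem hnot,
    Finset.card_image_of_injective _ hinj]

/-- Swapping two points on which a predicate agrees preserves the predicate. -/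
private theorem swap_mem_iff {α : Type*} [DecidableEq α] (P : α → Prop) {c d : α}
    (h : P c ↔ P d) (z : α) : P (Equiv.swap c d z) ↔ P z := by
  rcases eq_or_ne z c with rfl | hzc
  · rw [Equiv.swap_apply_left, h]
  rcases eq_or_ne z d with rfl | hzd
  · rw [Equiv.swap_apply_right, h]
  rw [Equiv.swap_apply_of_ne_of_ne hzc hzd]

/-- `M x ∘ swap (a i) q = swap (b i) q ∘ M x` when `x i = 1`. -/
private theorem map_swap
    (hM : ∀ x, Function.Involutive (M x) ∧ (∀ i, x i = true → M x (a i) = b i) ∧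
      (∀ i, x i = false → M x (a i) = a i) ∧ M x q = q)
    (x : Fin u → Bool) {i : Fin u} (hx : x i = true) (r : Fin n) :
    M x (Equiv.swap (a i) q r) = Equiv.swap (b i) q (M x r) := by
  obtain ⟨hinv, hMa, -, hMq⟩ := hM x
  have hMb : M x (b i) = a i := by rw [← hMa i hx, hinv]
  rcases eq_or_ne r (a i) with rfl | hra
  · rw [Equiv.swap_apply_left, hMq, hMa i hx, Equiv.swap_apply_left]
  rcases eq_or_ne r q with rfl | hrq
  · rw [Equiv.swap_apply_right, hMa i hx, hMq, Equiv.swap_apply_right]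
  rw [Equiv.swap_apply_of_ne_of_ne hra hrq, Equiv.swap_apply_of_ne_of_ne]
  · intro h
    apply hra
    rw [← hinv r, h, hMb]
  · intro h
    apply hrq
    rw [← hinv r, h, hMq]

/-- Stabiliser transitivity: every answer is the image of the planted cell `(q, q)` under a pair
of row/column relabellings fixing both inputs (`(1, 1)` for the planted cell itself,
`(swap (a i) q, swap (b i) q)` for the answer `(a i, b i)`). -/
private theorem transitive (hab : ∀ i j, a i ≠ b j) (haq : ∀ i, a i ≠ q)
    (hM : ∀ x, Function.Involutive (M x) ∧ (∀ i, x i = true → M x (a i) = b i) ∧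
      (∀ i, x i = false → M x (a i) = a i) ∧ M x q = q)
    (x y : Fin u → Bool) (e : Fin n × Fin n) (hA : decide (e.2 = M x e.1) = true)
    (hB : (!decide ((e.1 = q ∨ ∃ i, y i = true ∧ e.1 = a i) ∧ ¬ ∃ i, y i = true ∧ e.2 = a i)) =
      false) :
    ∃ α β : Equiv.Perm (Fin n),
      (∀ c : Fin n × Fin n, decide (β c.2 = M x (α c.1)) = decide (c.2 = M x c.1)) ∧
      (∀ c : Fin n × Fin n,
        (!decide ((α c.1 = q ∨ ∃ i, y i = true ∧ α c.1 = a i) ∧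
            ¬ ∃ i, y i = true ∧ β c.2 = a i)) =
          !decide ((c.1 = q ∨ ∃ i, y i = true ∧ c.1 = a i) ∧ ¬ ∃ i, y i = true ∧ c.2 = a i)) ∧
      (α q, β q) = e := by
  rcases (answer_iff hab haq hM x y e).1 ⟨hA, hB⟩ with rfl | ⟨i, hxy, rfl⟩
  · exact ⟨1, 1, fun c => rfl, fun c => rfl, rfl⟩
  · obtain ⟨hxi, hyi⟩ := Bool.and_eq_true_iff.1 hxy
    refine ⟨Equiv.swap (a i) q, Equiv.swap (b i) q, fun c => ?_, fun c => ?_, ?_⟩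
    · rw [map_swap hM x hxi]
      simp only [EmbeddingLike.apply_eq_iff_eq]
    · have h1 : (Equiv.swap (a i) q c.1 = q ∨ ∃ j, y j = true ∧ Equiv.swap (a i) q c.1 = a j) ↔
          (c.1 = q ∨ ∃ j, y j = true ∧ c.1 = a j) :=
        swap_mem_iff (fun r => r = q ∨ ∃ j, y j = true ∧ r = a j)
          ⟨fun _ => Or.inl rfl, fun _ => Or.inr ⟨i, hyi, rfl⟩⟩ c.1
      have h2 : (∃ j, y j = true ∧ Equiv.swap (b i) q c.2 = a j) ↔
          ∃ j, y j = true ∧ c.2 = a j :=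
        swap_mem_iff (fun r => ∃ j, y j = true ∧ r = a j)
          ⟨fun ⟨j, _, h⟩ => absurd h.symm (hab j i), fun ⟨j, _, h⟩ => absurd h.symm (haq j)⟩ c.2
      simp only [h1, h2]
    · simp

/-- The block embedding for abstract gadget data `a`, `b`, `q`, `M`. -/
private theorem core (ha : Function.Injective a) (hab : ∀ i j, a i ≠ b j) (haq : ∀ i, a i ≠ q)
    (hM : ∀ x, Function.Involutive (M x) ∧ (∀ i, x i = true → M x (a i) = b i) ∧
      (∀ i, x i = false → M x (a i) = a i) ∧ M x q = q) :
    ∃ (eA : (Fin u → Bool) → (Fin n × Fin n → Bool))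
      (eB : (Fin u → Bool) → (Fin n × Fin n → Bool)) (p : Fin n × Fin n),
      (∀ x, perfectMatchingFn n (eA x) = true) ∧
      (∀ y, perfectMatchingFn n (eB y) = false) ∧
      (∀ x y, eA x p = true ∧ eB y p = false) ∧
      (∀ x y, (Finset.univ.filter fun e : Fin n × Fin n =>
          eA x e = true ∧ eB y e = false).card =
        (Finset.univ.filter fun i : Fin u => (x i && y i) = true).card + 1) ∧
      (∀ x y (e : Fin n × Fin n), eA x e = true → eB y e = false →
        ∃ α β : Equiv.Perm (Fin n),
          (∀ c : Fin n × Fin n, eA x (α c.1, β c.2) = eA x c) ∧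
          (∀ c : Fin n × Fin n, eB y (α c.1, β c.2) = eB y c) ∧
          (α p.1, β p.2) = e) := by
  refine ⟨fun x e => decide (e.2 = M x e.1),
    fun y e => !decide ((e.1 = q ∨ ∃ i, y i = true ∧ e.1 = a i) ∧ ¬ ∃ i, y i = true ∧ e.2 = a i),
    (q, q), fun x => pm_inA (fun x => (hM x).1) x, fun y => pm_inB haq y,
    fun x y => (answer_iff hab haq hM x y (q, q)).2 (Or.inl rfl),
    fun x y => card_answers ha hab haq hM x y,
    fun x y e hA hB => transitive hab haq hM x y e hA hB⟩

end Core

/-! ### The stub -/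

/-- **Planted block embedding** (Raz–Wigderson 1992, Thm. 4.2, vertex duplication;
Rao–Yehudayoff, Thm. 9.5, planted edge). For `2u + 1 ≤ n` there are maps `eA`, `eB` from `u`-bit
vectors to `n × n` Boolean matrices and a planted cell `p` such that every `eA x` has a perfect
matching, no `eB y` has one, `p` is always an answer of the monotone Karchmer–Wigderson game
(set for Alice, unset for Bob), the number of answers of `(eA x, eB y)` is `|x ∩ y| + 1`, and for
every answer `e` some pair of row/column relabellings fixes both inputs and maps `p` to `e`. -/
theorem stub_embedding :
    ∀ (n u : ℕ), 2 * u + 1 ≤ n →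
      ∃ (eA : (Fin u → Bool) → (Fin n × Fin n → Bool))
        (eB : (Fin u → Bool) → (Fin n × Fin n → Bool)) (p : Fin n × Fin n),
        (∀ x, perfectMatchingFn n (eA x) = true) ∧
        (∀ y, perfectMatchingFn n (eB y) = false) ∧
        (∀ x y, eA x p = true ∧ eB y p = false) ∧
        (∀ x y, (Finset.univ.filter fun e : Fin n × Fin n =>
            eA x e = true ∧ eB y e = false).card =
          (Finset.univ.filter fun i : Fin u => (x i && y i) = true).card + 1) ∧
        (∀ x y (e : Fin n × Fin n), eA x e = true → eB y e = false →
          ∃ α β : Equiv.Perm (Fin n),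
            (∀ c : Fin n × Fin n, eA x (α c.1, β c.2) = eA x c) ∧
            (∀ c : Fin n × Fin n, eB y (α c.1, β c.2) = eB y c) ∧
            (α p.1, β p.2) = e) := by
  intro n u hn
  obtain ⟨a, b, q, ha, hb, hab, haq, hbq⟩ := exists_gadget hn
  choose M hM using exists_involution ha hb hab haq hbq
  exact core ha hab haq hM

end Summit.ValiantsHypothesis.ValiantsHypothesis.Theorems.ShallowShadowsRazWigdersonMatching
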